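import Mathlib
import HarnessLib
import Summits.ResolutionOfSingularities.ResolutionOfSingularities.Theorems.HomologicalConductorPersistenceLatticeCasimir
import Summits.ResolutionOfSingularities.ResolutionOfSingularities.Theorems.HomologicalConductorPersistenceLatticeDivisibility

/-!
# Crux `Persistence` (stmt-ResolutionOfSingularities-16484), chain W4.4b — LEMMA D′: Higman's
# criterion for BINOMIAL extensions `R = A[z]/(zⁿ − c)` (both directions)

Route `ResolutionOfSingularities/HomologicalConductor`.  OURS (cell res-hironaka, crux chain W4.4b,
CHAIN v13.2 §V13.10 K-E8 P1′ «general-γ Lemma D′ for (z³+t⁵) × line»; seat res-D-pv-058, object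
«U14′»); nothing here is a statement of the manuscript under review (Hironaka 2017); AI-written,
weaker than expert review.  Generalises `…PersistenceLatticeDivisibility` / `…PersistenceLatticeCasimir`
(U14, the case `c = 0`).

SETTING.  `A` a commutative ring, `R` a commutative `A`-algebra with a power basis `pb`, `z := pb.gen`,
and **`hc : z ^ pb.dim = algebraMap A R c`** for some `c : A` — so `R ≅ A[z]/(zⁿ − c)`, `n = dim`:
`c = 0` is U14; `A = k[u,t]`, `c = −t⁴` resp. `−t⁵` give the `E₆` / `E₈` CURVE × LINE rings
`k[u,t][z]/(z³ + t⁴)`, `k[u,t][z]/(z³ + t⁵)` (K-C3's arena, K-E8's P1′); `c = x y` gives Knörrer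
partners.  `M` an `R`-module (`IsScalarTower A R M`); `N := (z • ·)`.

* `repr_gen_mul_succ'` — multiplication by `z` still SHIFTS the power-basis coordinates `j ↦ j+1`
  (only coordinate `0` wraps, to `c · x_{n−1}`);
* **LEMMA D′** `repr_linearMap_eq'` / `linearMap_apply_eq_sum'` — every `R`-linear `α : M → R` is
  `v ↦ Σ_j λ(N^{n−1−j} v) z^j`, `λ =` top coordinate of `α` (the dual basis of `z^j` under the
  top-coefficient form is `z^{n−1−j}`, exactly as for `zⁿ`: Higman's criterion for the symmetric
  `A`-order `A[z]/(zⁿ − c)`);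
* **`exists_smul_eq_pow_smul_of_stablyAnnihilates'`** — if `z` acts as `t • N₀` then every STABLE
  ANNIHILATOR of `M` acts as `t^{n−1} • Θ` (divisibility);
* **`not_stablyAnnihilates_of_basis'`** (+ `_of_lt'`) — the NOT-table for Jordan-type lattices
  (`z e₀ = 0`, `z e_{i+1} = t^γ e_i`), verbatim as in U14;
* **`stablyAnnihilates_of_smul_eq_casimir'`** — CONVERSE: if `M` is f.g. projective over `A` and `c'`
  acts as a Casimir map `Σ_j z^j Θ z^{n−1−j}`, then `c'` stably annihilates `M` (through `R ⊗_A M`;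
  the two boundary terms of the commutation are now both `c • (1 ⊗ Θ v)`).

[folklore]/OURS: Higman's criterion for free Frobenius `A`-orders, binomial case.
IN-TREE PRIOR WORK: res-L1-w44b-idea-2's `…Theorems.HomologicalConductor.PersistencePencil`
(p495130) proves the same criterion for `O[z]/(zⁿ⁺¹)` in COORDINATES (`comp_eq_pencilSum`,
`exists_factor_of_pencilSum`, `pencilSum_eq_pow`, `not_pencilSum_chain`: a module is an `O`-module
with an endomorphism `Z`, a map to a free module is a pair `S, T` intertwining `Z` and the shift);
the present files state it for the tree's `StablyAnnihilates` (ModuleCat factorisations through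
arbitrary finitely generated projectives), which is the currency of CA1 / U10 / the `caⁿ` pipeline.
-/

noncomputable section

-- single-problem summit: the doubled namespace component `ResolutionOfSingularities` is forced
set_option linter.dupNamespace false

open CategoryTheory TensorProduct
open Summit.ResolutionOfSingularities.ResolutionOfSingularities.Theorems.NoZeno.SandwichCluster
open Summit.ResolutionOfSingularities.ResolutionOfSingularities.Theorems.HomologicalConductor.PersistenceLatticeDivisibility
open Summit.ResolutionOfSingularities.ResolutionOfSingularities.Theorems.HomologicalConductor.PersistenceLatticeCasimir
open scoped TensorProduct

universe u v

namespace Summit.ResolutionOfSingularities.ResolutionOfSingularities.Theorems.HomologicalConductor.PersistenceLatticeBinomial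

variable {A : Type v} [CommRing A] {R : Type u} [CommRing R] [Algebra A R]

/-! ## The shift `j ↦ j + 1` survives `zⁿ = c` -/

/-- `z · z^i = basis (i+1)` if `i + 1 < dim`, else `= algebraMap c` (`zⁿ = c`). [folklore] -/
theorem gen_mul_basis' (pb : PowerBasis A R) {c : A} (hc : pb.gen ^ pb.dim = algebraMap A R c)
    (i : Fin pb.dim) :
    pb.gen * pb.basis i =
      if h : (i : ℕ) + 1 < pb.dim then pb.basis ⟨(i : ℕ) + 1, h⟩ else algebraMap A R c := by
  rw [pb.basis_eq_pow, ← pow_succ']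
  split_ifs with h
  · rw [pb.basis_eq_pow]
  · have hi : (i : ℕ) + 1 = pb.dim := by have := i.2; omega
    rw [hi, hc]

/-- The positive coordinates of `algebraMap c = c · z^0` vanish. [folklore] -/
theorem repr_algebraMap_succ (pb : PowerBasis A R) (c : A) (j : ℕ) (hj : j + 1 < pb.dim) :
    pb.basis.repr (algebraMap A R c) ⟨j + 1, hj⟩ = 0 := by
  have h1 : algebraMap A R c = c • pb.basis ⟨0, by omega⟩ := by
    rw [pb.basis_eq_pow, Fin.val_mk, pow_zero, Algebra.algebraMap_eq_smul_one]
  rw [h1, map_smul, Finsupp.smul_apply, pb.basis.repr_self, Finsupp.single_apply, if_neg, smul_zero]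
  intro e
  have := Fin.ext_iff.mp e
  simp at this

/-- The `(j+1)`-st coordinate of `z · x` is the `j`-th coordinate of `x` (also when `zⁿ = c ≠ 0`).
[folklore] -/
theorem repr_gen_mul_succ' (pb : PowerBasis A R) {c : A} (hc : pb.gen ^ pb.dim = algebraMap A R c)
    (j : ℕ) (hj : j + 1 < pb.dim) (x : R) :
    pb.basis.repr (pb.gen * x) ⟨j + 1, hj⟩ = pb.basis.repr x ⟨j, by omega⟩ := by
  suffices h : (Finsupp.lapply (⟨j + 1, hj⟩ : Fin pb.dim)) ∘ₗ pb.basis.repr.toLinearMap ∘ₗ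
      LinearMap.mulLeft A pb.gen =
      (Finsupp.lapply (⟨j, by omega⟩ : Fin pb.dim)) ∘ₗ pb.basis.repr.toLinearMap from
    LinearMap.congr_fun h x
  refine pb.basis.ext fun i => ?_
  simp only [LinearMap.coe_comp, Function.comp_apply, LinearMap.mulLeft_apply,
    LinearEquiv.coe_coe, Finsupp.lapply_apply]
  rw [gen_mul_basis' pb hc, pb.basis.repr_self, Finsupp.single_apply]
  by_cases h : (i : ℕ) + 1 < pb.dim
  · rw [dif_pos h, pb.basis.repr_self, Finsupp.single_apply]
    by_cases hij : (i : ℕ) = j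
    · rw [if_pos (Fin.ext (by simp [hij])), if_pos (Fin.ext (by simp [hij]))]
    · rw [if_neg (fun e => hij (by have := Fin.ext_iff.mp e; simp at this; omega)),
        if_neg (fun e => hij (by have := Fin.ext_iff.mp e; simpa using this))]
  · rw [dif_neg h, repr_algebraMap_succ pb c j hj, if_neg]
    intro e
    have := Fin.ext_iff.mp e
    simp at this
    omega

/-! ## LEMMA D′ -/

section LemmaD

variable (pb : PowerBasis A R) {M : Type u} [AddCommGroup M] [Module R M] [Module A M]
  [IsScalarTower A R M]

omit [Module A M] [IsScalarTower A R M] in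
/-- **LEMMA D′ (coordinates)**: for an `R`-linear `α : M → R` and `n < dim`, the coordinate of index
`dim − 1 − n` of `α v` is the top coordinate of `α (zⁿ • v)` — for `R = A[z]/(z^{dim} − c)`. [OURS] -/
theorem repr_linearMap_eq' {c : A} (hc : pb.gen ^ pb.dim = algebraMap A R c) (α : M →ₗ[R] R)
    (n : ℕ) (hn : n < pb.dim) (v : M) :
    pb.basis.repr (α v) ⟨pb.dim - 1 - n, by omega⟩ =
      pb.basis.repr (α ((pb.gen ^ n) • v)) ⟨pb.dim - 1, by omega⟩ := by
  induction n generalizing v with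
  | zero => simp
  | succ n ih =>
    have h1 : pb.basis.repr (α v) ⟨pb.dim - 1 - (n + 1), by omega⟩ =
        pb.basis.repr (pb.gen * α v) ⟨pb.dim - 1 - n, by omega⟩ := by
      have e : pb.dim - 1 - (n + 1) + 1 = pb.dim - 1 - n := by omega
      have := repr_gen_mul_succ' pb hc (pb.dim - 1 - (n + 1)) (by omega) (α v)
      rw [← this]
      exact congrArg _ (Fin.ext e)
    rw [h1, ← smul_eq_mul, ← map_smul, ih (by omega) (pb.gen • v), smul_smul, ← pow_succ]

omit [Module A M] [IsScalarTower A R M] in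
/-- **LEMMA D′ (expansion)**: every `R`-linear `α : M → R` is `v ↦ Σ_n λ(zⁿ • v) · z^{dim−1−n}`,
`λ =` the top coordinate of `α` — for `R = A[z]/(z^{dim} − c)`. [OURS] -/
theorem linearMap_apply_eq_sum' {c : A} (hc : pb.gen ^ pb.dim = algebraMap A R c)
    (α : M →ₗ[R] R) (hd : 0 < pb.dim) (v : M) :
    α v = ∑ n : Fin pb.dim,
      pb.basis.repr (α ((pb.gen ^ (n : ℕ)) • v)) ⟨pb.dim - 1, by omega⟩ •
        pb.gen ^ (pb.dim - 1 - (n : ℕ)) := by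
  conv_lhs => rw [← pb.basis.sum_repr (α v)]
  rw [← Equiv.sum_comp Fin.revPerm]
  refine Finset.sum_congr rfl fun n _ => ?_
  have hrev : ((Fin.revPerm n : Fin pb.dim) : ℕ) = pb.dim - 1 - (n : ℕ) := by
    rw [Fin.revPerm_apply, Fin.val_rev]
    omega
  rw [pb.basis_eq_pow, hrev]
  congr 1
  rw [← repr_linearMap_eq' pb hc α n n.2 v]
  exact congrArg _ (Fin.ext hrev)

/-- **LEMMA D′ + DIVISIBILITY** for `R = A[z]/(z^{dim} − c)`: if `z` acts on `M` as `t • N₀`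
(`t : A`, `N₀` `A`-linear) and `c' ∈ R` STABLY ANNIHILATES `M`, then `c'` acts as `t ^ (dim − 1) • Θ`
for some `A`-linear `Θ`.  (Proof as in U14: re-route through `Rⁿ`, expand each `α_l` by LEMMA D′.)
[OURS] -/
theorem exists_smul_eq_pow_smul_of_stablyAnnihilates' {c : A}
    (hc : pb.gen ^ pb.dim = algebraMap A R c) (t : A) (N₀ : M →ₗ[A] M)
    (hN : ∀ m : M, pb.gen • m = t • N₀ m) {c' : R}
    (h : StablyAnnihilates R c' (ModuleCat.of R M)) :
    ∃ Θ : M →ₗ[A] M, ∀ m : M, c' • m = t ^ (pb.dim - 1) • Θ m := by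
  rcases Nat.eq_zero_or_pos pb.dim with hd | hd
  · have h1 : (1 : R) = 0 := by
      haveI : IsEmpty (Fin pb.dim) := by rw [hd]; infer_instance
      simpa using (pb.basis.sum_repr (1 : R)).symm
    refine ⟨0, fun m => ?_⟩
    have hm : m = 0 := by rw [← one_smul R m, h1, zero_smul]
    simp [hm]
  obtain ⟨P, hPfin, hP, ι, π, hιπ⟩ := h
  haveI := hP
  haveI : Module.Projective R P := P.projective_of_module_projective
  obtain ⟨n, f, hf⟩ := Module.Finite.exists_fin' R P
  obtain ⟨s, hs⟩ := Module.projective_lifting_property f LinearMap.id hf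
  let α : Fin n → M →ₗ[R] R := fun l => (LinearMap.proj l) ∘ₗ s ∘ₗ ι.hom
  let w : Fin n → M := fun l => π.hom (f (fun j => if l = j then 1 else 0))
  have hcv : ∀ v : M, c' • v = ∑ l, α l v • w l := by
    intro v
    have h1 : π.hom (ι.hom v) = c' • v := apply_apply_eq_smul_of_comp_eq_smul_id hιπ v
    have h2 : ι.hom v = f (s (ι.hom v)) := by
      rw [← LinearMap.comp_apply, hs, LinearMap.id_apply]
    rw [← h1, h2, ← LinearMap.comp_apply, LinearMap.pi_apply_eq_sum_univ]
    rfl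
  let lam : Fin n → M →ₗ[A] A := fun l =>
    (Finsupp.lapply (⟨pb.dim - 1, by omega⟩ : Fin pb.dim)) ∘ₗ pb.basis.repr.toLinearMap ∘ₗ
      (α l).restrictScalars A
  have hlam : ∀ l v, lam l v = pb.basis.repr (α l v) ⟨pb.dim - 1, by omega⟩ := fun l v => rfl
  refine ⟨∑ l : Fin n, ∑ j : Fin pb.dim,
    (LinearMap.toSpanSingleton A M ((N₀ ^ (pb.dim - 1 - (j : ℕ))) (w l))) ∘ₗ (lam l) ∘ₗ
      (N₀ ^ (j : ℕ)), fun v => ?_⟩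
  rw [hcv v]
  simp only [LinearMap.sum_apply, LinearMap.coe_comp, Function.comp_apply,
    LinearMap.toSpanSingleton_apply, Finset.smul_sum]
  refine Finset.sum_congr rfl fun l _ => ?_
  rw [linearMap_apply_eq_sum' pb hc (α l) hd v, Finset.sum_smul]
  refine Finset.sum_congr rfl fun j _ => ?_
  have hjle : (j : ℕ) ≤ pb.dim - 1 := by have := j.2; omega
  rw [← hlam l, smul_assoc, gen_pow_smul_eq pb t N₀ hN, gen_pow_smul_eq pb t N₀ hN, map_smul,
    smul_eq_mul, smul_smul, smul_smul]
  congr 1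
  rw [mul_right_comm, ← pow_add, Nat.add_sub_cancel' hjle]

/-- **The NOT-table over `A[z]/(z^{dim} − c)`**: for a Jordan-type lattice (`A`-basis `e₀,…,e_{k−1}`,
`z e₀ = 0`, `z e_{i+1} = t^γ e_i`), `a < k` and `t^{γ (dim−1)} ∤ t^{γ a + c₀}`:
`z^a t^{c₀}` does NOT stably annihilate `M`. [OURS] -/
theorem not_stablyAnnihilates_of_basis' {c : A} (hc : pb.gen ^ pb.dim = algebraMap A R c) (t : A)
    (γ : ℕ) {k : ℕ} (b : Module.Basis (Fin k) A M)
    (h0 : ∀ h : 0 < k, pb.gen • b ⟨0, h⟩ = 0)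
    (hS : ∀ (i : ℕ) (h : i + 1 < k), pb.gen • b ⟨i + 1, h⟩ = t ^ γ • b ⟨i, by omega⟩)
    (a c₀ : ℕ) (ha : a < k) (ht : ¬ t ^ (γ * (pb.dim - 1)) ∣ t ^ (γ * a + c₀)) :
    ¬ StablyAnnihilates R (pb.gen ^ a * algebraMap A R (t ^ c₀)) (ModuleCat.of R M) := by
  intro h
  obtain ⟨N₀, hN⟩ := exists_shift pb b (t ^ γ) h0 hS
  obtain ⟨Θ, hΘ⟩ := exists_smul_eq_pow_smul_of_stablyAnnihilates' pb hc (t ^ γ) N₀ hN h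
  have key := hΘ (b ⟨0 + a, by omega⟩)
  rw [mul_smul, algebraMap_smul, smul_comm, gen_pow_smul_basis pb b (t ^ γ) hS a 0 (by omega)]
    at key
  have := congrArg (b.coord ⟨0, by omega⟩) key
  simp only [map_smul, Module.Basis.coord_apply, b.repr_self, Finsupp.single_eq_same, smul_eq_mul,
    mul_one] at this
  rw [← pow_mul, ← pow_mul, mul_comm (t ^ c₀), ← pow_add] at this
  exact ht (Dvd.intro _ this.symm)

/-- The NOT-table with the divisibility hypothesis in degree form (`t` a non-zero non-unit of a
domain, `γ a + c₀ < γ (dim − 1)`). [OURS] -/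
theorem not_stablyAnnihilates_of_basis_of_lt' [IsDomain A] {c : A}
    (hc : pb.gen ^ pb.dim = algebraMap A R c) (t : A) (ht0 : t ≠ 0) (htu : ¬ IsUnit t) (γ : ℕ)
    {k : ℕ} (b : Module.Basis (Fin k) A M)
    (h0 : ∀ h : 0 < k, pb.gen • b ⟨0, h⟩ = 0)
    (hS : ∀ (i : ℕ) (h : i + 1 < k), pb.gen • b ⟨i + 1, h⟩ = t ^ γ • b ⟨i, by omega⟩)
    (a c₀ : ℕ) (ha : a < k) (hlt : γ * a + c₀ < γ * (pb.dim - 1)) :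
    ¬ StablyAnnihilates R (pb.gen ^ a * algebraMap A R (t ^ c₀)) (ModuleCat.of R M) :=
  not_stablyAnnihilates_of_basis' pb hc t γ b h0 hS a c₀ ha
    (by rw [pow_dvd_pow_iff ht0 htu]; omega)

end LemmaD

/-! ## The converse: Casimir maps over `A[z]/(zⁿ − c)` -/

section Casimir

variable (pb : PowerBasis A R) {M : Type u} [AddCommGroup M] [Module R M] [Module A M]
  [IsScalarTower A R M]

/-- The Casimir sum `Σ_{j<dim} z^j ⊗ Θ(z^{dim−1−j} • v)` commutes with `z` when `z^dim = c ∈ A`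
(the two boundary terms both equal `c • (1 ⊗ Θ v)`). [folklore; Higman] -/
theorem casimir_commute' {c : A} (hc : pb.gen ^ pb.dim = algebraMap A R c) (hd : 0 < pb.dim)
    (Θ : M →ₗ[A] M) (v : M) :
    (∑ j ∈ Finset.range pb.dim,
        (pb.gen ^ j) ⊗ₜ[A] Θ ((pb.gen ^ (pb.dim - 1 - j)) • (pb.gen • v))) =
      pb.gen • ∑ j ∈ Finset.range pb.dim, (pb.gen ^ j) ⊗ₜ[A] Θ ((pb.gen ^ (pb.dim - 1 - j)) • v) := by
  obtain ⟨d, hdd⟩ : ∃ d, pb.dim = d + 1 := ⟨pb.dim - 1, by omega⟩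
  rw [hdd, Finset.sum_range_succ', Finset.smul_sum, Finset.sum_range_succ]
  have h0 : (pb.gen ^ 0 : R) ⊗ₜ[A] Θ ((pb.gen ^ (d + 1 - 1 - 0)) • (pb.gen • v)) =
      c • ((1 : R) ⊗ₜ[A] Θ v) := by
    rw [← mul_smul, ← pow_succ, show d + 1 - 1 - 0 + 1 = pb.dim by omega, hc, algebraMap_smul,
      map_smul, pow_zero, TensorProduct.tmul_smul]
  have htop : pb.gen • ((pb.gen ^ d : R) ⊗ₜ[A] Θ ((pb.gen ^ (d + 1 - 1 - d)) • v)) =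
      c • ((1 : R) ⊗ₜ[A] Θ v) := by
    rw [show d + 1 - 1 - d = 0 by omega, pow_zero, one_smul, TensorProduct.smul_tmul', smul_eq_mul,
      ← pow_succ', show d + 1 = pb.dim by omega, hc, Algebra.algebraMap_eq_smul_one,
      ← TensorProduct.smul_tmul']
  rw [h0, htop]
  congr 1
  refine Finset.sum_congr rfl fun j hj => ?_
  have hj' : j < d := Finset.mem_range.mp hj
  rw [TensorProduct.smul_tmul', smul_eq_mul, ← pow_succ', ← mul_smul, ← pow_succ,
    show d + 1 - 1 - (j + 1) + 1 = d + 1 - 1 - j by omega]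

/-- **CONVERSE OF LEMMA D′** over `R = A[z]/(z^{dim} − c)`: if `M` is finitely generated projective
over `A` and `c' ∈ R` acts as the Casimir map `v ↦ Σ_{j<dim} z^j • Θ(z^{dim−1−j} • v)` of an
`A`-linear `Θ`, then `c'` stably annihilates `M` (through `R ⊗_A M`). [folklore; Higman] -/
theorem stablyAnnihilates_of_smul_eq_casimir' [Module.Finite A M] [Module.Projective A M] {c : A}
    (hc : pb.gen ^ pb.dim = algebraMap A R c) (hd : 0 < pb.dim) (Θ : M →ₗ[A] M) (c' : R)
    (hc' : ∀ v : M, c' • v =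
      ∑ j ∈ Finset.range pb.dim, (pb.gen ^ j) • Θ ((pb.gen ^ (pb.dim - 1 - j)) • v)) :
    StablyAnnihilates R c' (ModuleCat.of R M) := by
  let N : M →ₗ[A] M := (LinearMap.lsmul R M pb.gen).restrictScalars A
  have hN : ∀ (n : ℕ) (v : M), (N ^ n) v = (pb.gen ^ n) • v := by
    intro n
    induction n with
    | zero => intro v; simp
    | succ n ih =>
      intro v
      rw [pow_succ', Module.End.mul_apply, ih, pow_succ', mul_smul]
      rfl
  let ι₀ : M →ₗ[A] R ⊗[A] M :=
    ∑ j ∈ Finset.range pb.dim, (TensorProduct.mk A R M (pb.gen ^ j)) ∘ₗ Θ ∘ₗ (N ^ (pb.dim - 1 - j))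
  have hι₀ : ∀ v, ι₀ v =
      ∑ j ∈ Finset.range pb.dim, (pb.gen ^ j) ⊗ₜ[A] Θ ((pb.gen ^ (pb.dim - 1 - j)) • v) := by
    intro v
    simp only [ι₀, LinearMap.sum_apply, LinearMap.coe_comp, Function.comp_apply,
      TensorProduct.mk_apply, hN]
  have hcomm : ∀ v, ι₀ (pb.gen • v) = pb.gen • ι₀ v := fun v => by
    rw [hι₀, hι₀, casimir_commute' pb hc hd Θ v]
  let ι : M →ₗ[R] R ⊗[A] M :=
    { toFun := ι₀
      map_add' := fun v w => ι₀.map_add v w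
      map_smul' := fun x v => map_smul_of_commute_gen pb ι₀ hcomm x v }
  let π : R ⊗[A] M →ₗ[R] M := (LinearMap.id : M →ₗ[A] M).liftBaseChange R
  refine ⟨ModuleCat.of R (R ⊗[A] M), inferInstance,
    (IsProjective.iff_projective (R := R) (R ⊗[A] M)).mp inferInstance,
    ModuleCat.ofHom ι, ModuleCat.ofHom π, ?_⟩
  ext v
  have h1 : π (ι v) = c' • v := by
    change π (ι₀ v) = c' • v
    rw [hι₀, map_sum, hc' v]
    refine Finset.sum_congr rfl fun j _ => ?_
    rw [LinearMap.liftBaseChange_tmul, LinearMap.id_apply]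
  simpa [ModuleCat.hom_comp, ModuleCat.hom_ofHom] using h1

end Casimir

end Summit.ResolutionOfSingularities.ResolutionOfSingularities.Theorems.HomologicalConductor.PersistenceLatticeBinomial
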